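import Literature.Probability.RandomPlanarGeometry.HexSAWBrickWallStripFugacityWidthOneExact
import Literature.Probability.RandomPlanarGeometry.HexSAWBrickWallStripFugacityTwoSidedProp6
import HarnessLib

/-!
# Two fugacities on the one-cell honeycomb strip: `μ_1(y,z)²(μ_1(y,z)² − y)(μ_1(y,z)² − z) ≤ yz`, and `μ_1(y,1)² ≤ y + 1/(y−1)`

Topic `Literature/Probability/RandomPlanarGeometry` (continues `HexSAWBrickWallStripFugacityWidthOneExact.lean` — and `…TwoSidedProp6.lean` for `stripMuY₂_mono_right` —: the structure lemma
`LadderPot.other_site_visited_of_reversal` of SAW on the two-row ladder `S_1`, the observables `nV / hd / gd`, the forward flag `fwF`,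
and the phase-potential method at equal fugacities).  Source of the objects: N. R. Beaton, M. Bousquet-Mélou, J. de Gier,
H. Duminil-Copin, A. J. Guttmann, Comm. Math. Phys. 326 (2014), arXiv:1109.0358v5, §3.2 Proposition 6 (p. 10): the two-fugacity
rate `μ_T(y,z) = lim C_{T,n}(y,z)^{1/n}` (`HexBW.stripMuY₂ T y z`), weights `y^{bc} z^{tc}`, and its one-variable case
`μ_T(y,1) = HexBW.stripMuY₀ T y` (Proposition 7, p. 11).  Here `T = 1` with two DIFFERENT fugacities.  New in writing (elementary),
to our reading: the explicit algebraic UPPER bound below; the matching lower bound (which would make it the exact value, as at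
`z = y` in the previous file) needs two-row switch words with separate row counts and is NOT proved here.

## The argument

The phase potential of the previous file is made ROW-DEPENDENT (`LVals2`, `phase2`, `phiAt2`: the same five phases — initial run,
first rung, forward, later rung, corridor — read off the same observables plus the row flag `rwF`), for the two-fugacity weight
(`wAt`: `y` at the odd columns of the bottom row, `z` at those of the top row, `pow_visits_succ₂`).  The sixteen one-step
inequalities (`LValid2`) are proved fibrewise exactly as before (`sum_fibre_le2`; the corridor exclusion is the imported structure
lemma), so `C_{1,N}(y,z) ≤ const·ρ^N` and `μ_1(y,z) ≤ ρ` (`stripMuY₂_one_le_of_valid2`).  They are SOLVED at every `ρ > 0` with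
`y, z < ρ²` and `yz < D := ρ²(ρ²−y)(ρ²−z)` (`lvals2`, `lvalid2`): forward `fA = (1, α)`, `α = ρ(ρ²−y)(D+yz)/(2zD)`, `fB = ρ·fA`,
later rung onto row `b`: `(ρ² − w_{¬b})·fA_{¬b}`, corridor `κ_b·fA_b` with `κ_bottom = (D−yz)/(2yz)`, `κ_top = (D−yz)/(D+yz)` (so
`(1+κ_bottom)(1+κ_top) = D/(yz)`: the two balance identities `w_b fA_b (1+κ_b) = ρ(ρ²−w_{¬b}) fA_{¬b}`), first rung `2w·fA/ρ`,
initial run `2 w_{¬b} fA_{¬b}/(ρ² − w_b)` and `/ρ`.  Hence ★★ `stripMuY₂_one_le`: **`μ_1(y,z) ≤ ρ` for every such `ρ`**, and by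
continuity (`stripMuY₂_one_sq_poly_le`) **`s(s−y)(s−z) ≤ yz` for `s = μ_1(y,z)²` whenever `max(y,z) ≤ s`**.  At `z = 1 ≤ y`
(`μ_1(y,1) = stripMuY₀ 1 y ≥ √y`, tree): **`s(s−y)(s−1) ≤ y`**, whence ★★ **`μ_1(y,1)² ≤ y + 1/(y−1)`** for every `y > 1`
(`stripMuY₀_one_sq_le_add_inv`; the lane's lower bound is `y + 3/(10y)`).

## Statements (all PROVED, standard axioms)

Namespace `….HexBW.LadderPot2`: `rwF`, `wgt`, `wAt`, `pow_visits_succ₂`, `wAt_eq`, `visits_pref₂`, `LVals2`, `phase2`, `phiAt2`,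
`LValid2`, `m8`, `pmin2` (+ positivity / minimality lemmas), `cv2`, ★★ `sum_fibre_le2`, `potSum2`, `potSum2_succ_le`,
`potSum2_le_pow_mul`, `stripZ₂_le_potSum2_div`, ★ `stripMuY₂_one_le_of_valid2`, `Dv`, `αv`, `fAv`, `κv`, `lvals2`, ★ `lvalid2`,
★★ **`stripMuY₂_one_le`** (`0 < y, z < ρ²`, `yz < ρ²(ρ²−y)(ρ²−z)` ⇒ `μ_1(y,z) ≤ ρ`).
Namespace `….HexBW`: ★★ **`stripMuY₂_one_sq_poly_le`**, ★★ `stripMuY₂_one_sq_poly_le_of_one_le` (hypothesis-free for `y, z ≥ 1`),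
`sqrt_le_stripMuY₂_of_one_le` (`√y ≤ μ_T(y,z)`, `T ≥ 1`, `y ≥ 1`, `z > 0`), ★★ `stripMuY₂_one_sq_poly_le_of_one_le_left` (hypothesis-free for
`y ≥ 1`, any `z > 0` — one attractive wall, the other arbitrary),
★★ `stripMuY₀_one_sq_poly_le` (`s(s−y)(s−1) ≤ y`, `s = μ_1(y,1)²`, `y ≥ 1`), ★★ **`stripMuY₀_one_sq_le_add_inv`** (`μ_1(y,1)² ≤ y + 1/(y−1)`,
`y > 1`).

NOT claimed: equality in the sextic (lower bound missing for `z ≠ y`); anything for `T ≥ 2`.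
-/

noncomputable section

open Filter Topology Finset Literature.Probability.LatticeModels Literature.Probability.Percolation SimpleGraph

namespace Literature.Probability.RandomPlanarGeometry.SAW.HexBW

namespace LadderPot2

open WallPot LadderPot

variable {y z ρ : ℝ} {N : ℕ} {p p' : Site 2 × (ℕ → Site 2)}

/-! ### §1 Row flag and the two-fugacity site weight -/

/-- The bottom-row flag of the `n`-th site. [cite: BeatonBousquetMelouDeGierDuminilCopinGuttmann2014, §3.2 (arXiv v5 p. 10: bc(ω))] -/
def rwF (p : Site 2 × (ℕ → Site 2)) (n : ℕ) : Bool := decide (siteAt p n 1 = 0)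

/-- The wall weight of a row: `y` on the bottom row, `z` on the top row. [cite: BeatonBousquetMelouDeGierDuminilCopinGuttmann2014, §3.2 (arXiv v5 p. 10)] -/
def wgt (y z : ℝ) (b : Bool) : ℝ := if b = true then y else z

/-- The two-fugacity weight factor of the `m`-th site, in the literal form of `bottomVisits₀_succ'` / `topVisits₀_succ'`.
[cite: BeatonBousquetMelouDeGierDuminilCopinGuttmann2014, §3.2 (arXiv v5 p. 10: bc(ω), tc(ω))] -/
def wAt (y z : ℝ) (p : Site 2 × (ℕ → Site 2)) (m : ℕ) : ℝ :=
  (if (p.1 + p.2 m) 1 = 0 ∧ (p.1 + p.2 m) 0 % 2 = 1 then y else 1) *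
    (if (p.1 + p.2 m) 1 = ((1 : ℕ) : ℤ) ∧ ((p.1 + p.2 m) 0 + (1 : ℕ)) % 2 = 0 then z else 1)

/-- The two-fugacity weight grows by the factor `wAt`. [cite: BeatonBousquetMelouDeGierDuminilCopinGuttmann2014, §3.2 (arXiv v5 p. 10)] -/
theorem pow_visits_succ₂ (y z : ℝ) (p : Site 2 × (ℕ → Site 2)) (N : ℕ) :
    y ^ bottomVisits₀ p.1 p.2 (N + 1) * z ^ topVisits₀ 1 p.1 p.2 (N + 1) =
      y ^ bottomVisits₀ p.1 p.2 N * z ^ topVisits₀ 1 p.1 p.2 N * wAt y z p (N + 1) := by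
  rw [bottomVisits₀_succ', topVisits₀_succ', wAt]
  split_ifs <;> simp [pow_succ] <;> ring

/-- On `S_1`: `wAt = 1` at even columns, `= y` (bottom) / `z` (top) at odd columns. [cite: BeatonBousquetMelouDeGierDuminilCopinGuttmann2014, §3.2 (arXiv v5 p. 10)] -/
theorem wAt_eq {n : ℕ} (hp : p ∈ stripPairs 1 n) (y z : ℝ) {m : ℕ} (hm : m ≤ n) :
    wAt y z p m = if colAt p m % 2 = 0 then 1 else wgt y z (rwF p m) := by
  have r01 := row01 hp hm
  unfold siteAt at r01
  unfold wAt wgt rwF colAt siteAt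
  simp only [Nat.cast_one]
  rcases r01 with h | h
  · by_cases hx : (p.1 + p.2 m) 0 % 2 = 0
    · rw [if_neg (by rintro ⟨-, h'⟩; omega), if_neg (by rintro ⟨h', -⟩; omega), if_pos hx]; ring
    · have hx1 : (p.1 + p.2 m) 0 % 2 = 1 := by omega
      rw [if_pos ⟨h, hx1⟩, if_neg (by rintro ⟨h', -⟩; omega), if_neg hx]; simp [h]
  · by_cases hx : (p.1 + p.2 m) 0 % 2 = 0
    · rw [if_neg (by rintro ⟨h', -⟩; omega), if_neg (by rintro ⟨-, h'⟩; omega), if_pos hx]; ring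
    · have hx2 : ((p.1 + p.2 m) 0 + 1) % 2 = 0 := by omega
      rw [if_neg (by rintro ⟨h', -⟩; omega), if_pos ⟨h, hx2⟩, if_neg hx]; simp [h]

/-- Prefix bookkeeping of the visit counts (two fugacities). [cite: BeatonBousquetMelouDeGierDuminilCopinGuttmann2014, §3.2 (arXiv v5 p. 10)] -/
theorem visits_pref₂ (p : Site 2 × (ℕ → Site 2)) (N : ℕ) :
    bottomVisits₀ (pref N p).1 (pref N p).2 N = bottomVisits₀ p.1 p.2 N ∧ topVisits₀ 1 (pref N p).1 (pref N p).2 N = topVisits₀ 1 p.1 p.2 N := by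
  unfold bottomVisits₀ topVisits₀ pref
  constructor
  · refine Finset.sum_congr rfl fun m hm => ?_
    have := Finset.mem_range.1 hm; simp only [min_eq_left (by omega : m ≤ N)]
  · refine Finset.sum_congr rfl fun m hm => ?_
    have := Finset.mem_range.1 hm; simp only [min_eq_left (by omega : m ≤ N)]

/-! ### §2 The row-dependent phase potential -/

/-- Row-dependent potential values (argument: `true` = bottom row). [cite: MadrasSlade1993, §1.2 (elementary counting)] -/
structure LVals2 where
  /-- initial run, even column -/
  runE : Bool → ℝ
  /-- initial run, odd column -/
  runO : Bool → ℝ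
  /-- just after the first vertical step (now on this row) -/
  rg1 : Bool → ℝ
  /-- forward phase, odd column -/
  fA : Bool → ℝ
  /-- forward phase, even column -/
  fB : Bool → ℝ
  /-- just after a later vertical step (now on this row) -/
  rg2 : Bool → ℝ
  /-- corridor, odd column -/
  coO : Bool → ℝ
  /-- corridor, even column -/
  coE : Bool → ℝ

/-- The row-dependent phase potential. [cite: MadrasSlade1993, §1.2 (elementary counting)] -/
def phase2 (P : LVals2) (b : Bool) (k : ℕ) (v fw ev : Bool) : ℝ :=
  if k = 0 then (if ev = true then P.runE b else P.runO b)
  else if v = true then (if k = 1 then P.rg1 b else P.rg2 b)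
  else if fw = true then (if ev = true then P.fB b else P.fA b)
  else (if ev = true then P.coE b else P.coO b)

/-- The potential of a walk after `N + 1` steps. [cite: MadrasSlade1993, §1.2 (elementary counting)] -/
def phiAt2 (P : LVals2) (p : Site 2 × (ℕ → Site 2)) (N : ℕ) : ℝ :=
  phase2 P (rwF p (N + 1)) (nV p (N + 1)) (vertAt p N) (fwF p (N + 1)) (evF p (N + 1))

/-- **Sub-harmonicity at rate `ρ`** of the row-dependent phase potential for the weights `(y, z)`. [cite: MadrasSlade1993, §1.2 (elementary counting)] -/
structure LValid2 (y z ρ : ℝ) (P : LVals2) : Prop where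
  pos_y : 0 < y
  pos_z : 0 < z
  pos_ρ : 0 < ρ
  pos_runE : ∀ b, 0 < P.runE b
  pos_runO : ∀ b, 0 < P.runO b
  pos_rg1 : ∀ b, 0 < P.rg1 b
  pos_fA : ∀ b, 0 < P.fA b
  pos_fB : ∀ b, 0 < P.fB b
  pos_rg2 : ∀ b, 0 < P.rg2 b
  pos_coO : ∀ b, 0 < P.coO b
  pos_coE : ∀ b, 0 < P.coE b
  run_o : ∀ b, P.runE b ≤ ρ * P.runO b
  run_e : ∀ b, wgt y z b * P.runO b + P.rg1 (!b) ≤ ρ * P.runE b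
  rg1_le : ∀ b, wgt y z b * P.fA b + wgt y z b * P.fA b ≤ ρ * P.rg1 b
  fwd_o : ∀ b, P.fB b ≤ ρ * P.fA b
  fwd_e : ∀ b, wgt y z b * P.fA b + P.rg2 (!b) ≤ ρ * P.fB b
  rg2_le : ∀ b, wgt y z b * P.fA b + wgt y z b * P.coO b ≤ ρ * P.rg2 b
  co_o : ∀ b, P.coE b ≤ ρ * P.coO b
  co_e : ∀ b, wgt y z b * P.coO b ≤ ρ * P.coE b

variable {P : LVals2}

/-- The least potential value on a row. [cite: MadrasSlade1993, §1.2 (elementary counting)] -/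
def m8 (P : LVals2) (b : Bool) : ℝ :=
  min (P.runE b) (min (P.runO b) (min (P.rg1 b) (min (P.fA b) (min (P.fB b) (min (P.rg2 b) (min (P.coO b) (P.coE b)))))))

/-- The least potential value. [cite: MadrasSlade1993, §1.2 (elementary counting)] -/
def pmin2 (P : LVals2) : ℝ := min (m8 P true) (m8 P false)

/-- `0 < m8`. [cite: MadrasSlade1993, §1.2 (elementary counting)] -/
theorem m8_pos (hV : LValid2 y z ρ P) (b : Bool) : 0 < m8 P b := by
  unfold m8
  have := hV.pos_runE b; have := hV.pos_runO b; have := hV.pos_rg1 b; have := hV.pos_fA b; have := hV.pos_fB b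
  have := hV.pos_rg2 b; have := hV.pos_coO b; have := hV.pos_coE b
  positivity

/-- `0 < pmin2`. [cite: MadrasSlade1993, §1.2 (elementary counting)] -/
theorem pmin2_pos (hV : LValid2 y z ρ P) : 0 < pmin2 P := lt_min (m8_pos hV true) (m8_pos hV false)

/-- `m8 ≤ phase2`. [cite: MadrasSlade1993, §1.2 (elementary counting)] -/
theorem m8_le_phase2 (P : LVals2) (b : Bool) (k : ℕ) (v fw ev : Bool) : m8 P b ≤ phase2 P b k v fw ev := by
  unfold m8 phase2
  have h1 := min_le_left (P.runE b) (min (P.runO b) (min (P.rg1 b) (min (P.fA b) (min (P.fB b) (min (P.rg2 b) (min (P.coO b) (P.coE b)))))))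
  have h2 := min_le_right (P.runE b) (min (P.runO b) (min (P.rg1 b) (min (P.fA b) (min (P.fB b) (min (P.rg2 b) (min (P.coO b) (P.coE b)))))))
  have h3 := min_le_left (P.runO b) (min (P.rg1 b) (min (P.fA b) (min (P.fB b) (min (P.rg2 b) (min (P.coO b) (P.coE b))))))
  have h4 := min_le_right (P.runO b) (min (P.rg1 b) (min (P.fA b) (min (P.fB b) (min (P.rg2 b) (min (P.coO b) (P.coE b))))))
  have h5 := min_le_left (P.rg1 b) (min (P.fA b) (min (P.fB b) (min (P.rg2 b) (min (P.coO b) (P.coE b)))))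
  have h6 := min_le_right (P.rg1 b) (min (P.fA b) (min (P.fB b) (min (P.rg2 b) (min (P.coO b) (P.coE b)))))
  have h7 := min_le_left (P.fA b) (min (P.fB b) (min (P.rg2 b) (min (P.coO b) (P.coE b))))
  have h8 := min_le_right (P.fA b) (min (P.fB b) (min (P.rg2 b) (min (P.coO b) (P.coE b))))
  have h9 := min_le_left (P.fB b) (min (P.rg2 b) (min (P.coO b) (P.coE b)))
  have h10 := min_le_right (P.fB b) (min (P.rg2 b) (min (P.coO b) (P.coE b)))
  have h11 := min_le_left (P.rg2 b) (min (P.coO b) (P.coE b))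
  have h12 := min_le_right (P.rg2 b) (min (P.coO b) (P.coE b))
  have h13 := min_le_left (P.coO b) (P.coE b)
  have h14 := min_le_right (P.coO b) (P.coE b)
  split_ifs <;> linarith

/-- `pmin2 ≤ phase2`. [cite: MadrasSlade1993, §1.2 (elementary counting)] -/
theorem pmin2_le_phase2 (P : LVals2) (b : Bool) (k : ℕ) (v fw ev : Bool) : pmin2 P ≤ phase2 P b k v fw ev := by
  refine le_trans ?_ (m8_le_phase2 P b k v fw ev)
  unfold pmin2; cases b
  · exact min_le_right _ _
  · exact min_le_left _ _

/-- `0 < phase2`. [cite: MadrasSlade1993, §1.2 (elementary counting)] -/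
theorem phase2_pos (hV : LValid2 y z ρ P) (b : Bool) (k : ℕ) (v fw ev : Bool) : 0 < phase2 P b k v fw ev :=
  (pmin2_pos hV).trans_le (pmin2_le_phase2 P b k v fw ev)

/-- Evaluation in the initial run. [cite: MadrasSlade1993, §1.2 (elementary counting)] -/
theorem phase2_run (P : LVals2) (b : Bool) {k : ℕ} (hk : k = 0) (v fw ev : Bool) :
    phase2 P b k v fw ev = if ev = true then P.runE b else P.runO b := by simp [phase2, hk]
/-- Evaluation just after a vertical step. [cite: MadrasSlade1993, §1.2 (elementary counting)] -/
theorem phase2_vert (P : LVals2) (b : Bool) {k : ℕ} (hk : k ≠ 0) (fw ev : Bool) :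
    phase2 P b k true fw ev = if k = 1 then P.rg1 b else P.rg2 b := by simp [phase2, hk]
/-- Evaluation in the forward phase. [cite: MadrasSlade1993, §1.2 (elementary counting)] -/
theorem phase2_fwd (P : LVals2) (b : Bool) {k : ℕ} (hk : k ≠ 0) (ev : Bool) :
    phase2 P b k false true ev = if ev = true then P.fB b else P.fA b := by simp [phase2, hk]
/-- Evaluation in a corridor. [cite: MadrasSlade1993, §1.2 (elementary counting)] -/
theorem phase2_co (P : LVals2) (b : Bool) {k : ℕ} (hk : k ≠ 0) (ev : Bool) :
    phase2 P b k false false ev = if ev = true then P.coE b else P.coO b := by simp [phase2, hk]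

/-- `0 ≤ wgt`. [cite: BeatonBousquetMelouDeGierDuminilCopinGuttmann2014, §3.2 (arXiv v5 p. 10)] -/
theorem wgt_nonneg (hy : 0 < y) (hz : 0 < z) (b : Bool) : 0 ≤ wgt y z b := by
  unfold wgt; split_ifs
  · exact hy.le
  · exact hz.le

/-- The value attached to a code, seen from the data `(row b, column x, heading-before-last-rung G, rungs k)` of the prefix.
[cite: MadrasSlade1993, §1.2 (elementary counting)] -/
def cv2 (y z : ℝ) (P : LVals2) (b : Bool) (x G : ℤ) (k : ℕ) (c : ℕ) : ℝ :=
  if c = 2 then (if k = 0 then P.rg1 (!b) else P.rg2 (!b))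
  else (if (x + dirOf c) % 2 = 0 then 1 else wgt y z b) *
    phase2 P b k false (decide (k = 1 ∨ dirOf c = G)) (decide ((x + dirOf c) % 2 = 0))

/-- `0 ≤ cv2`. [cite: MadrasSlade1993, §1.2 (elementary counting)] -/
theorem cv2_nonneg (hV : LValid2 y z ρ P) (b : Bool) (x G : ℤ) (k c : ℕ) : 0 ≤ cv2 y z P b x G k c := by
  unfold cv2
  split_ifs
  · exact (hV.pos_rg1 _).le
  · exact (hV.pos_rg2 _).le
  · exact mul_nonneg zero_le_one (phase2_pos hV _ _ _ _ _).le
  · exact mul_nonneg (wgt_nonneg hV.pos_y hV.pos_z b) (phase2_pos hV _ _ _ _ _).le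

open Classical in
/-- **The fibre inequality with two fugacities** (same anatomy as `LadderPot.sum_fibre_le`; the row is tracked: horizontal steps keep it,
vertical steps flip it). [cite: MadrasSlade1993, §1.2 (elementary counting); EntingJensen2009, §7.4.2, Fig. 7.10] -/
theorem sum_fibre_le2 (hV : LValid2 y z ρ P) (hp' : p' ∈ stripPairs 1 (N + 1)) :
    ∑ p ∈ (stripPairs 1 (N + 1 + 1)).filter (fun p => pref (N + 1) p = p'),
        wAt y z p (N + 1 + 1) * phiAt2 P p (N + 1) ≤ ρ * phiAt2 P p' N := by
  set F := (stripPairs 1 (N + 1 + 1)).filter (fun p => pref (N + 1) p = p') with hF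
  set k := nV p' (N + 1) with hk
  set x := colAt p' (N + 1) with hx
  set G := gd p' (N + 1) with hG
  set b := rwF p' (N + 1) with hb
  have hy := hV.pos_y
  have hz := hV.pos_z
  have r01' := row01 hp' (le_refl (N + 1))
  -- anatomy of a member of the fibre
  have anat : ∀ p ∈ F, p ∈ stripPairs 1 (N + 1 + 1) ∧ pref (N + 1) p = p' ∧ (∀ i ≤ N + 1, siteAt p i = siteAt p' i) ∧
      vertAt p N = vertAt p' N ∧ nV p (N + 1) = k ∧ hd p (N + 1) = hd p' (N + 1) ∧ gd p (N + 1) = G ∧ colAt p (N + 1) = x := by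
    intro p hp
    obtain ⟨hpS, hpre⟩ := Finset.mem_filter.1 hp
    have hs : ∀ i ≤ N + 1, siteAt p i = siteAt p' i := fun i hi => siteAt_eq_of_pref_eq hpre hi
    obtain ⟨hv, hn, hh, hg, hc⟩ := obs_congr hs
    exact ⟨hpS, hpre, hs, hv N (Nat.lt_succ_self N), hn, hh, hg, hc⟩
  -- (i) the summand is the code value
  have hval : ∀ p ∈ F, wAt y z p (N + 1 + 1) * phiAt2 P p (N + 1) = cv2 y z P b x G k (lastCode N p) := by
    intro p hp
    obtain ⟨hpS, -, hs, hvN, hn, hh, hg, hc⟩ := anat p hp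
    rw [wAt_eq hpS y z le_rfl]
    have hn2 : nV p (N + 1 + 1) = k + (if vertAt p (N + 1) = true then 1 else 0) := by rw [nV_succ, hn]
    have hrow1 : siteAt p (N + 1) 1 = siteAt p' (N + 1) 1 := by rw [hs (N + 1) le_rfl]
    cases hvv : vertAt p (N + 1)
    · -- horizontal last step
      obtain ⟨hrow, hcol⟩ := horiz_step hpS (Nat.lt_succ_self _) hvv
      have hc01 : (lastCode N p = 0 ∧ colAt p (N + 1 + 1) = x + 1) ∨ (lastCode N p = 1 ∧ colAt p (N + 1 + 1) = x - 1) := by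
        unfold colAt at hc ⊢
        rcases hcol with h | h
        · left; refine ⟨by unfold lastCode; rw [hvv]; simp [h], by rw [h, hc]⟩
        · right; refine ⟨by unfold lastCode; rw [hvv]; simp [show ¬(siteAt p (N + 1 + 1) 0 = siteAt p (N + 1) 0 + 1) by omega], by rw [h, hc]⟩
      have hcode : lastCode N p ≠ 2 := by rcases hc01 with ⟨h, -⟩ | ⟨h, -⟩ <;> rw [h] <;> norm_num
      have hdir : colAt p (N + 1 + 1) = x + dirOf (lastCode N p) := by
        rcases hc01 with ⟨h, h'⟩ | ⟨h, h'⟩ <;> rw [h, h'] <;> simp [sub_eq_add_neg]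
      have hhd2 : hd p (N + 1 + 1) = dirOf (lastCode N p) := by rw [hd_succ_of_horiz hvv, hdir, hc]; ring
      have hgd2 : gd p (N + 1 + 1) = G := by rw [gd_succ_of_horiz hvv, hg]
      have hrw2 : rwF p (N + 1 + 1) = b := by unfold rwF; rw [hrow, hrow1, hb]; rfl
      rw [hvv] at hn2; simp only [Bool.false_eq_true, if_false, add_zero] at hn2
      unfold phiAt2 fwF evF
      rw [hn2, hvv, hhd2, hgd2, hdir, hrw2, cv2, if_neg hcode]
    · -- vertical last step
      obtain ⟨vc, vr, veven⟩ := vert_step hpS (Nat.lt_succ_self _) hvv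
      have hcode : lastCode N p = 2 := by unfold lastCode; rw [hvv]; simp
      have hcol2 : colAt p (N + 1 + 1) % 2 = 0 := by unfold colAt; rw [vc]; exact veven
      have hrw2 : rwF p (N + 1 + 1) = !b := by
        unfold rwF; rw [vr, hrow1, hb]; unfold rwF
        rcases r01' with h | h <;> rw [h] <;> simp
      rw [hvv] at hn2; simp only [if_true] at hn2
      unfold phiAt2
      rw [hn2, hvv, hcode, hrw2, cv2, if_pos rfl, if_pos hcol2, one_mul, phase2_vert P _ (Nat.succ_ne_zero k)]
      simp
  -- (ii) the code is injective on the fibre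
  have hinj : Set.InjOn (lastCode N) ↑F := by
    intro p₁ h₁ p₂ h₂ hcd
    rw [Finset.mem_coe] at h₁ h₂
    obtain ⟨hS₁, hpre₁, hs₁, -⟩ := anat p₁ h₁
    obtain ⟨hS₂, hpre₂, hs₂, -⟩ := anat p₂ h₂
    refine eq_of_pref_eq_of_siteAt_eq hS₁ hS₂ (hpre₁.trans hpre₂.symm) ?_
    have e₁ := last_step_coord (N := N + 1) hS₁
    have e₂ := last_step_coord (N := N + 1) hS₂
    have hx₁ := hs₁ (N + 1) le_rfl
    have hx₂ := hs₂ (N + 1) le_rfl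
    rw [site_two_eq_iff] at hx₁ hx₂
    have r₁ := row01 hS₁ (le_refl (N + 1 + 1)); have r₁' := row01 hS₁ (Nat.le_succ (N + 1))
    have r₂ := row01 hS₂ (le_refl (N + 1 + 1)); have r₂' := row01 hS₂ (Nat.le_succ (N + 1))
    unfold lastCode vertAt at hcd
    simp only [decide_eq_true_eq] at hcd
    rw [site_two_eq_iff]
    split_ifs at hcd <;> omega
  -- (iii) rewrite the sum over codes
  have hsum : ∑ p ∈ F, wAt y z p (N + 1 + 1) * phiAt2 P p (N + 1) = ∑ c ∈ F.image (lastCode N), cv2 y z P b x G k c := by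
    rw [Finset.sum_image hinj]; exact Finset.sum_congr rfl hval
  rw [hsum]
  have bound : ∀ s : Finset ℕ, F.image (lastCode N) ⊆ s → ∑ c ∈ F.image (lastCode N), cv2 y z P b x G k c ≤ ∑ c ∈ s, cv2 y z P b x G k c :=
    fun s hs => Finset.sum_le_sum_of_subset_of_nonneg hs fun c _ _ => cv2_nonneg hV b x G k c
  have img : ∀ c ∈ F.image (lastCode N), ∃ p ∈ F, lastCode N p = c := fun c hc => by simpa [Finset.mem_image] using hc
  have hkN : phiAt2 P p' N = phase2 P b k (vertAt p' N) (fwF p' (N + 1)) (evF p' (N + 1)) := rfl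
  have hw : wgt y z b = if b = true then y else z := rfl
  cases hvN : vertAt p' N
  · ---------------- last step of the prefix horizontal ----------------
    obtain ⟨hrow, hcol⟩ := horiz_step hp' (Nat.lt_succ_self N) hvN
    have hhd : hd p' (N + 1) = colAt p' (N + 1) - colAt p' N := hd_succ_of_horiz hvN
    have hd1' : hd p' (N + 1) = 1 ∨ hd p' (N + 1) = -1 := by rw [hhd]; unfold colAt; omega
    obtain ⟨d, hdd⟩ : ∃ d, hd p' (N + 1) = d := ⟨_, rfl⟩
    have hd1 : d = 1 ∨ d = -1 := hdd ▸ hd1'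
    have hxd : colAt p' (N + 1) = colAt p' N + d := by rw [← hdd, hhd]; ring
    obtain ⟨c₀, hc₀, hc₀2, hdir₀⟩ : ∃ c₀ : ℕ, ((d = 1 ∧ c₀ = 0) ∨ (d = -1 ∧ c₀ = 1)) ∧ c₀ ≠ 2 ∧ dirOf c₀ = d := by
      rcases hd1 with h | h
      · exact ⟨0, Or.inl ⟨h, rfl⟩, by norm_num, by rw [h]; exact dirOf_zero⟩
      · exact ⟨1, Or.inr ⟨h, rfl⟩, by norm_num, by rw [h]; exact dirOf_one⟩
    have hsub : F.image (lastCode N) ⊆ ({c₀, 2} : Finset ℕ) := by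
      intro c hc
      obtain ⟨p, hp, rfl⟩ := img c hc
      obtain ⟨hpS, -, hs, -⟩ := anat p hp
      have e := last_step_coord (N := N + 1) hpS
      have hne := siteAt_add_two_ne hpS
      rw [Ne, site_two_eq_iff] at hne
      have hx₁ := hs (N + 1) le_rfl; have hx₀ := hs N (Nat.le_succ N)
      rw [site_two_eq_iff] at hx₁ hx₀
      rw [Finset.mem_insert, Finset.mem_singleton]
      unfold colAt at hxd
      unfold lastCode vertAt
      simp only [decide_eq_true_eq]
      rcases hc₀ with ⟨hdv, rfl⟩ | ⟨hdv, rfl⟩ <;> rw [hdv] at hxd <;> split_ifs <;> omega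
    have hsub' : x % 2 ≠ 0 ∨ (k ≠ 0 ∧ fwF p' (N + 1) = false) → F.image (lastCode N) ⊆ ({c₀} : Finset ℕ) := by
      intro hcase c hc
      have hc2 := hsub hc
      rw [Finset.mem_insert, Finset.mem_singleton] at hc2
      rw [Finset.mem_singleton]
      rcases hc2 with hc2 | hc2
      · exact hc2
      exfalso
      obtain ⟨p, hp, hpc⟩ := img c hc
      obtain ⟨hpS, -, hs, -, hn, hh, hg, hcx⟩ := anat p hp
      have hvv : vertAt p (N + 1) = true := by
        by_contra hv'
        have hv'' : vertAt p (N + 1) = false := by simpa using hv'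
        have : lastCode N p ≠ 2 := by unfold lastCode; rw [hv'']; simp only [Bool.false_eq_true, if_false]; split_ifs <;> omega
        exact this (hpc.trans hc2)
      obtain ⟨vc, vr, veven⟩ := vert_step hpS (Nat.lt_succ_self _) hvv
      rcases hcase with hodd | ⟨hk0, hfw⟩
      · apply hodd; rw [← hcx]; unfold colAt; exact veven
      · have hk1 : ¬(k = 1 ∨ hd p' (N + 1) = G) := by
          intro h; unfold fwF at hfw; rw [← hk, ← hG] at hfw; simp only [decide_eq_false_iff_not] at hfw; exact hfw h
        have hk1a : k ≠ 1 := fun h => hk1 (Or.inl h)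
        have hk1b : hd p' (N + 1) ≠ G := fun h => hk1 (Or.inr h)
        have h2 : 2 ≤ nV p' (N + 1) := by rw [← hk]; omega
        obtain ⟨m, hm, hm0, hm1⟩ := other_site_visited_of_reversal hp' hvN h2 (by rw [← hG]; exact hk1b)
        have he : siteAt p (N + 1 + 1) = siteAt p m := by
          rw [hs m hm, site_two_eq_iff]
          have := hs (N + 1) le_rfl
          rw [site_two_eq_iff] at this
          unfold colAt at hm0
          constructor <;> omega
        have := time_eq_of_siteAt_eq hpS le_rfl (by omega) he
        omega
    have hev' : ((x + d) % 2 = 0) ↔ ¬(x % 2 = 0) := by rcases hd1 with h | h <;> rw [h] <;> omega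
    by_cases hk0 : k = 0
    · rw [hkN, phase2_run P b hk0]
      by_cases hxe : x % 2 = 0
      · refine (bound _ hsub).trans ?_
        rw [Finset.sum_pair hc₀2]
        have hxo : ¬((x + d) % 2 = 0) := by rw [hev']; exact not_not.2 hxe
        simp only [cv2, hc₀2, if_false, if_true, hdir₀, hxo, hk0, phase2, decide_false]
        unfold evF; rw [← hx]; simp only [hxe, decide_true, if_true]
        simp
        linarith [hV.run_e b]
      · refine (bound _ (hsub' (Or.inl hxe))).trans ?_
        rw [Finset.sum_singleton]
        have hxo : (x + d) % 2 = 0 := by rw [hev']; exact hxe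
        simp only [cv2, hc₀2, if_false, if_true, hdir₀, hxo, hk0, phase2]
        unfold evF; rw [← hx]; simp only [hxe, decide_false]
        simp
        linarith [hV.run_o b]
    · cases hfw : fwF p' (N + 1)
      · have hfw' : decide (k = 1 ∨ d = G) = false := by unfold fwF at hfw; rw [← hk, hdd, ← hG] at hfw; exact hfw
        rw [hkN, hvN, hfw, phase2_co P b hk0]
        refine (bound _ (hsub' (Or.inr ⟨hk0, hfw⟩))).trans ?_
        rw [Finset.sum_singleton]
        by_cases hxe : x % 2 = 0
        · have hxo : ¬((x + d) % 2 = 0) := by rw [hev']; exact not_not.2 hxe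
          simp only [cv2, hc₀2, if_false, hdir₀, hxo, hfw', phase2_co P b hk0, decide_false]
          unfold evF; rw [← hx]; simp only [hxe, decide_true, if_true]
          simp
          linarith [hV.co_e b]
        · have hxo : (x + d) % 2 = 0 := by rw [hev']; exact hxe
          simp only [cv2, hc₀2, if_false, if_true, hdir₀, hxo, hfw', phase2_co P b hk0, decide_true]
          unfold evF; rw [← hx]; simp only [hxe, decide_false]
          simp
          linarith [hV.co_o b]
      · have hfw' : decide (k = 1 ∨ d = G) = true := by unfold fwF at hfw; rw [← hk, hdd, ← hG] at hfw; exact hfw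
        rw [hkN, hvN, hfw, phase2_fwd P b hk0]
        by_cases hxe : x % 2 = 0
        · refine (bound _ hsub).trans ?_
          rw [Finset.sum_pair hc₀2]
          have hxo : ¬((x + d) % 2 = 0) := by rw [hev']; exact not_not.2 hxe
          simp only [cv2, hc₀2, if_false, if_true, hdir₀, hxo, hfw', phase2_fwd P b hk0, hk0, decide_false]
          unfold evF; rw [← hx]; simp only [hxe, decide_true, if_true]
          simp
          linarith [hV.fwd_e b]
        · refine (bound _ (hsub' (Or.inl hxe))).trans ?_
          rw [Finset.sum_singleton]
          have hxo : (x + d) % 2 = 0 := by rw [hev']; exact hxe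
          simp only [cv2, hc₀2, if_false, if_true, hdir₀, hxo, hfw', phase2_fwd P b hk0, decide_true]
          unfold evF; rw [← hx]; simp only [hxe, decide_false]
          simp
          linarith [hV.fwd_o b]
  · ---------------- last step of the prefix vertical ----------------
    obtain ⟨vc, vr, veven⟩ := vert_step hp' (Nat.lt_succ_self N) hvN
    have hxe : x % 2 = 0 := by rw [hx]; unfold colAt; rw [vc]; exact veven
    have hk1 : 1 ≤ k := by rw [hk, nV_succ, hvN]; simp
    have hk0 : k ≠ 0 := by omega
    have hsub : F.image (lastCode N) ⊆ ({0, 1} : Finset ℕ) := by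
      intro c hc
      obtain ⟨p, hp, rfl⟩ := img c hc
      obtain ⟨hpS, -, hs, -⟩ := anat p hp
      have e := last_step_coord (N := N + 1) hpS
      have hne := siteAt_add_two_ne hpS
      rw [Ne, site_two_eq_iff] at hne
      have hx₁ := hs (N + 1) le_rfl; have hx₀ := hs N (Nat.le_succ N)
      rw [site_two_eq_iff] at hx₁ hx₀
      have r2 := row01 hpS (le_refl (N + 1 + 1))
      have r1 := row01 hp' (le_refl (N + 1)); have r0 := row01 hp' (Nat.le_succ N)
      rw [Finset.mem_insert, Finset.mem_singleton]
      unfold lastCode vertAt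
      simp only [decide_eq_true_eq]
      split_ifs <;> omega
    refine (bound _ hsub).trans ?_
    rw [Finset.sum_pair (by norm_num), hkN, hvN, phase2_vert P b hk0]
    have hx1 : ¬((x + 1) % 2 = 0) := by omega
    have hx2 : ¬((x + -1) % 2 = 0) := by omega
    by_cases hk1' : k = 1
    · simp only [cv2, show (0:ℕ) ≠ 2 by norm_num, show (1:ℕ) ≠ 2 by norm_num, if_false, dirOf, if_true, one_ne_zero, hx1, hx2, hk1',
        true_or, decide_true, phase2_fwd P b one_ne_zero, decide_false]
      simp
      linarith [hV.rg1_le b]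
    · have hG1 : G = 1 ∨ G = -1 := by
        have hN : N ≠ 0 := by
          rintro rfl
          have : k = 1 := by rw [hk, nV_succ, hvN]; simp [nV]
          exact hk1' this
        obtain ⟨M, rfl⟩ := Nat.exists_eq_succ_of_ne_zero hN
        have hvM : vertAt p' M = false := by
          by_contra hc
          have hc' : vertAt p' M = true := by simpa using hc
          exact not_vert_vert hp' (by omega) hc' hvN
        have := horiz_step hp' (show M < M + 1 + 1 by omega) hvM
        rw [hG, gd_succ_of_vert hvN, hd_succ_of_horiz hvM]
        unfold colAt; omega
      simp only [cv2, show (0:ℕ) ≠ 2 by norm_num, show (1:ℕ) ≠ 2 by norm_num, if_false, dirOf, if_true, one_ne_zero, hx1, hx2, hk1',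
        false_or, decide_false, if_false]
      rcases hG1 with h | h
      · rw [h]; simp only [decide_true, show ((-1:ℤ) = 1) = False by norm_num, decide_false, phase2_fwd P b hk0, phase2_co P b hk0]
        simp
        linarith [hV.rg2_le b]
      · rw [h]; simp only [decide_true, show ((1:ℤ) = -1) = False by norm_num, decide_false, phase2_fwd P b hk0, phase2_co P b hk0]
        simp
        linarith [hV.rg2_le b]

/-! ### §3 Sub-geometric growth and `μ_1(y,z) ≤ ρ` -/

/-- The potential-weighted two-fugacity partition function at length `N + 1`. [cite: BeatonBousquetMelouDeGierDuminilCopinGuttmann2014, §3.2 (arXiv v5 p. 10: C_{T,k}(y,z))] -/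
def potSum2 (y z : ℝ) (P : LVals2) (N : ℕ) : ℝ :=
  ∑ p ∈ stripPairs 1 (N + 1), y ^ bottomVisits₀ p.1 p.2 (N + 1) * z ^ topVisits₀ 1 p.1 p.2 (N + 1) * phiAt2 P p N

/-- `0 ≤ potSum2`. [cite: MadrasSlade1993, §1.2 (elementary counting)] -/
theorem potSum2_nonneg (hV : LValid2 y z ρ P) (N : ℕ) : 0 ≤ potSum2 y z P N :=
  Finset.sum_nonneg fun _ _ => mul_nonneg (mul_nonneg (pow_nonneg hV.pos_y.le _) (pow_nonneg hV.pos_z.le _)) (phase2_pos hV _ _ _ _ _).le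

open Classical in
/-- **`potSum2 (N+1) ≤ ρ · potSum2 N`.** [cite: MadrasSlade1993, §1.2 (elementary counting)] -/
theorem potSum2_succ_le (hV : LValid2 y z ρ P) (N : ℕ) : potSum2 y z P (N + 1) ≤ ρ * potSum2 y z P N := by
  unfold potSum2
  have hmaps : ∀ p ∈ stripPairs 1 (N + 1 + 1), pref (N + 1) p ∈ stripPairs 1 (N + 1) := fun p hp => pref_mem hp
  rw [← Finset.sum_fiberwise_of_maps_to hmaps, Finset.mul_sum]
  refine Finset.sum_le_sum fun p' hp' => ?_
  have hfib : ∀ p ∈ (stripPairs 1 (N + 1 + 1)).filter (fun p => pref (N + 1) p = p'),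
      y ^ bottomVisits₀ p.1 p.2 (N + 1 + 1) * z ^ topVisits₀ 1 p.1 p.2 (N + 1 + 1) * phiAt2 P p (N + 1) =
        y ^ bottomVisits₀ p'.1 p'.2 (N + 1) * z ^ topVisits₀ 1 p'.1 p'.2 (N + 1) * (wAt y z p (N + 1 + 1) * phiAt2 P p (N + 1)) := by
    intro p hp
    obtain ⟨-, hpre⟩ := Finset.mem_filter.1 hp
    obtain ⟨hb, ht⟩ := visits_pref₂ p (N + 1)
    rw [pow_visits_succ₂, ← hpre, hb, ht, mul_assoc]
  rw [Finset.sum_congr rfl hfib, ← Finset.mul_sum]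
  have hy0 : 0 ≤ y ^ bottomVisits₀ p'.1 p'.2 (N + 1) * z ^ topVisits₀ 1 p'.1 p'.2 (N + 1) :=
    mul_nonneg (pow_nonneg hV.pos_y.le _) (pow_nonneg hV.pos_z.le _)
  calc y ^ bottomVisits₀ p'.1 p'.2 (N + 1) * z ^ topVisits₀ 1 p'.1 p'.2 (N + 1) *
        ∑ p ∈ (stripPairs 1 (N + 1 + 1)).filter (fun p => pref (N + 1) p = p'), wAt y z p (N + 1 + 1) * phiAt2 P p (N + 1)
      ≤ y ^ bottomVisits₀ p'.1 p'.2 (N + 1) * z ^ topVisits₀ 1 p'.1 p'.2 (N + 1) * (ρ * phiAt2 P p' N) :=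
        mul_le_mul_of_nonneg_left (sum_fibre_le2 hV hp') hy0
    _ = ρ * (y ^ bottomVisits₀ p'.1 p'.2 (N + 1) * z ^ topVisits₀ 1 p'.1 p'.2 (N + 1) * phiAt2 P p' N) := by ring

/-- `potSum2 N ≤ ρ^N · potSum2 0`. [cite: MadrasSlade1993, §1.2 (elementary counting)] -/
theorem potSum2_le_pow_mul (hV : LValid2 y z ρ P) (N : ℕ) : potSum2 y z P N ≤ ρ ^ N * potSum2 y z P 0 := by
  induction N with
  | zero => simp
  | succ N ih =>
    calc potSum2 y z P (N + 1) ≤ ρ * potSum2 y z P N := potSum2_succ_le hV N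
      _ ≤ ρ * (ρ ^ N * potSum2 y z P 0) := mul_le_mul_of_nonneg_left ih hV.pos_ρ.le
      _ = ρ ^ (N + 1) * potSum2 y z P 0 := by ring

/-- `C_{1,N+1}(y,z) ≤ potSum2 N / pmin2`. [cite: BeatonBousquetMelouDeGierDuminilCopinGuttmann2014, §3.2 (arXiv v5 p. 10: C_{T,k}(y,z))] -/
theorem stripZ₂_le_potSum2_div (hV : LValid2 y z ρ P) (N : ℕ) : stripZ₂ 1 (N + 1) y z ≤ potSum2 y z P N / pmin2 P := by
  have hm := pmin2_pos hV
  rw [le_div_iff₀ hm, stripZ₂, potSum2, Finset.sum_mul]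
  refine Finset.sum_le_sum fun p _ => ?_
  exact mul_le_mul_of_nonneg_left (pmin2_le_phase2 P _ _ _ _ _) (mul_nonneg (pow_nonneg hV.pos_y.le _) (pow_nonneg hV.pos_z.le _))

/-- **`μ_1(y,z) ≤ ρ`** whenever the row-dependent phase potential is sub-harmonic at rate `ρ`.
[cite: BeatonBousquetMelouDeGierDuminilCopinGuttmann2014, §3.2 Proposition 6 (arXiv v5 p. 10: μ_T(y,z) = lim C_{T,k}(y,z)^{1/k}); MadrasSlade1993, §8.2 (8.2.2)–(8.2.3)] -/
theorem stripMuY₂_one_le_of_valid2 (hV : LValid2 y z ρ P) : stripMuY₂ 1 y z ≤ ρ := by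
  have hy0 := hV.pos_y
  have hz0 := hV.pos_z
  have hρ := hV.pos_ρ
  have hm := pmin2_pos hV
  set C : ℝ := potSum2 y z P 0 / (pmin2 P * ρ) + 1 with hC
  have hC0 : 0 < C := by
    rw [hC]; have := div_nonneg (potSum2_nonneg hV 0) (mul_pos hm hρ).le; linarith
  have hb : ∀ N, stripZ₂ 1 (N + 1) y z ≤ C * ρ ^ (N + 1) := by
    intro N
    calc stripZ₂ 1 (N + 1) y z ≤ potSum2 y z P N / pmin2 P := stripZ₂_le_potSum2_div hV N
      _ ≤ ρ ^ N * potSum2 y z P 0 / pmin2 P := div_le_div_of_nonneg_right (potSum2_le_pow_mul hV N) hm.le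
      _ = potSum2 y z P 0 / (pmin2 P * ρ) * ρ ^ (N + 1) := by field_simp; ring
      _ ≤ C * ρ ^ (N + 1) := by rw [hC]; nlinarith [pow_pos hρ (N + 1)]
  have hL := tendsto_stripZ₂_rpow 1 hy0 hz0
  have hR : Tendsto (fun n : ℕ => C ^ (1 / (n : ℝ)) * ρ) atTop (𝓝 (1 * ρ)) :=
    (tendsto_const_rpow_one_div_nat₀ hC0).mul_const ρ
  rw [one_mul] at hR
  refine le_of_tendsto_of_tendsto hL hR (Filter.eventually_atTop.2 ⟨1, fun n hn => ?_⟩)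
  obtain ⟨N, rfl⟩ := Nat.exists_eq_add_of_le' hn
  have hZ0 : 0 ≤ stripZ₂ 1 (N + 1) y z := (stripZ₂_pos 1 _ hy0 hz0).le
  have e : C ^ (1 / ((N + 1 : ℕ) : ℝ)) * ρ = (C * ρ ^ (N + 1)) ^ (1 / ((N + 1 : ℕ) : ℝ)) := by
    rw [Real.mul_rpow hC0.le (pow_nonneg hρ.le _), one_div, Real.pow_rpow_inv_natCast hρ.le (Nat.succ_ne_zero N)]
  show stripZ₂ 1 (N + 1) y z ^ (1 / ((N + 1 : ℕ) : ℝ)) ≤ C ^ (1 / ((N + 1 : ℕ) : ℝ)) * ρ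
  rw [e]
  exact Real.rpow_le_rpow hZ0 (hb N) (by positivity)

/-! ### §4 The explicit row-dependent potential at every admissible rate -/

/-- `D = ρ²(ρ²−y)(ρ²−z)`. [cite: MadrasSlade1993, §1.2 (elementary counting)] -/
def Dv (y z ρ : ℝ) : ℝ := ρ ^ 2 * (ρ ^ 2 - y) * (ρ ^ 2 - z)

/-- The top-row forward value `α = ρ(ρ²−y)(D+yz)/(2zD)`. [cite: MadrasSlade1993, §1.2 (elementary counting)] -/
def αv (y z ρ : ℝ) : ℝ := ρ * (ρ ^ 2 - y) * (Dv y z ρ + y * z) / (2 * z * Dv y z ρ)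

/-- Forward values `(1, α)`. [cite: MadrasSlade1993, §1.2 (elementary counting)] -/
def fAv (y z ρ : ℝ) (b : Bool) : ℝ := if b = true then 1 else αv y z ρ

/-- Corridor slacks `κ(bottom) = (D−yz)/(2yz)`, `κ(top) = (D−yz)/(D+yz)` (so that `(1+κ_b)(1+κ_t) = D/(yz)`). [cite: MadrasSlade1993, §1.2 (elementary counting)] -/
def κv (y z ρ : ℝ) (b : Bool) : ℝ :=
  if b = true then (Dv y z ρ - y * z) / (2 * (y * z)) else (Dv y z ρ - y * z) / (Dv y z ρ + y * z)

/-- The explicit row-dependent potential at rate `ρ`. [cite: MadrasSlade1993, §1.2 (elementary counting)] -/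
def lvals2 (y z ρ : ℝ) : LVals2 where
  runE := fun b => 2 * wgt y z (!b) * fAv y z ρ (!b) / (ρ ^ 2 - wgt y z b)
  runO := fun b => 2 * wgt y z (!b) * fAv y z ρ (!b) / (ρ ^ 2 - wgt y z b) / ρ
  rg1 := fun b => 2 * wgt y z b * fAv y z ρ b / ρ
  fA := fAv y z ρ
  fB := fun b => ρ * fAv y z ρ b
  rg2 := fun b => (ρ ^ 2 - wgt y z (!b)) * fAv y z ρ (!b)
  coO := fun b => κv y z ρ b * fAv y z ρ b
  coE := fun b => wgt y z b * (κv y z ρ b * fAv y z ρ b) / ρ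

/-- **The explicit potential is sub-harmonic** for `0 < y, z < ρ²` and `yz < ρ²(ρ²−y)(ρ²−z)`. [cite: MadrasSlade1993, §1.2 (elementary counting)] -/
theorem lvalid2 (hy : 0 < y) (hz : 0 < z) (hρ : 0 < ρ) (hy2 : y < ρ ^ 2) (hz2 : z < ρ ^ 2)
    (hD : y * z < ρ ^ 2 * (ρ ^ 2 - y) * (ρ ^ 2 - z)) : LValid2 y z ρ (lvals2 y z ρ) := by
  have hDv : Dv y z ρ = ρ ^ 2 * (ρ ^ 2 - y) * (ρ ^ 2 - z) := rfl
  set D := Dv y z ρ with hDdef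
  rw [← hDv] at hD
  have hsy : 0 < ρ ^ 2 - y := by linarith
  have hsz : 0 < ρ ^ 2 - z := by linarith
  have hq : 0 < y * z := mul_pos hy hz
  have hD0 : 0 < D := hq.trans hD
  have hDq : 0 < D - y * z := by linarith
  have hDq' : 0 < D + y * z := by linarith
  have hαv : αv y z ρ = ρ * (ρ ^ 2 - y) * (D + y * z) / (2 * z * D) := rfl
  set α := αv y z ρ with hαdef
  have hα : 0 < α := by rw [hαv]; positivity
  have hκt : κv y z ρ true = (D - y * z) / (2 * (y * z)) := by simp [κv, hDdef]
  have hκf : κv y z ρ false = (D - y * z) / (D + y * z) := by simp [κv, hDdef]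
  have hκt0 : 0 < κv y z ρ true := by rw [hκt]; positivity
  have hκf0 : 0 < κv y z ρ false := by rw [hκf]; positivity
  have hft : fAv y z ρ true = 1 := by simp [fAv]
  have hff : fAv y z ρ false = α := by simp [fAv, hαdef]
  have hwt : wgt y z true = y := by simp [wgt]
  have hwf : wgt y z false = z := by simp [wgt]
  -- the two balance identities behind `rg2_le`
  have bal_t : y * 1 + y * ((D - y * z) / (2 * (y * z)) * 1) = ρ * ((ρ ^ 2 - z) * α) := by
    rw [hαv]; field_simp; rw [hDv]; ring
  have bal_f : z * α + z * ((D - y * z) / (D + y * z) * α) = ρ * ((ρ ^ 2 - y) * 1) := by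
    rw [hαv]; field_simp; rw [hDv]; ring
  refine ⟨hy, hz, hρ, ?_, ?_, ?_, ?_, ?_, ?_, ?_, ?_, ?_, ?_, ?_, ?_, ?_, ?_, ?_, ?_⟩
  all_goals intro b
  all_goals cases b
  all_goals simp only [lvals2, Bool.not_true, Bool.not_false, hft, hff, hwt, hwf, hκt, hκf]
  -- positivity (16 goals) and inequalities (16 goals), in field order (false case first for each)
  · positivity
  · positivity
  · positivity
  · positivity
  · positivity
  · positivity
  · exact hα
  · exact one_pos
  · positivity
  · positivity
  · positivity
  · positivity
  · positivity
  · positivity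
  · positivity
  · positivity
  -- run_o
  · exact le_of_eq (by field_simp)
  · exact le_of_eq (by field_simp)
  -- run_e
  · exact le_of_eq (by field_simp; ring)
  · exact le_of_eq (by field_simp; ring)
  -- rg1_le
  · exact le_of_eq (by field_simp; ring)
  · exact le_of_eq (by field_simp; ring)
  -- fwd_o
  · exact le_of_eq (by ring)
  · exact le_of_eq (by ring)
  -- fwd_e
  · exact le_of_eq (by ring)
  · exact le_of_eq (by ring)
  -- rg2_le
  · exact bal_f.le
  · exact bal_t.le
  -- co_o
  · rw [div_le_iff₀ hρ]
    have : 0 < (D - y * z) / (D + y * z) * α := by positivity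
    nlinarith
  · rw [div_le_iff₀ hρ]
    have : 0 < (D - y * z) / (2 * (y * z)) * 1 := by positivity
    nlinarith
  -- co_e
  · exact le_of_eq (by field_simp)
  · exact le_of_eq (by field_simp)

/-- ★★ **`μ_1(y,z) ≤ ρ` for every `ρ > 0` with `y, z < ρ²` and `yz < ρ²(ρ²−y)(ρ²−z)`.**
[cite: BeatonBousquetMelouDeGierDuminilCopinGuttmann2014, §3.2 Proposition 6 (arXiv v5 p. 10); MadrasSlade1993, §8.2 (8.2.2)–(8.2.3)] -/
theorem stripMuY₂_one_le (hy : 0 < y) (hz : 0 < z) (hρ : 0 < ρ) (hy2 : y < ρ ^ 2) (hz2 : z < ρ ^ 2)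
    (hD : y * z < ρ ^ 2 * (ρ ^ 2 - y) * (ρ ^ 2 - z)) : stripMuY₂ 1 y z ≤ ρ :=
  stripMuY₂_one_le_of_valid2 (lvalid2 hy hz hρ hy2 hz2 hD)

end LadderPot2

variable {y z : ℝ}

open LadderPot2 in
/-- ★★ **The sextic inequality `μ²(μ² − y)(μ² − z) ≤ yz` for `μ = μ_1(y,z)`**, whenever `max(y,z) ≤ μ_1(y,z)²` (`y, z > 0`): the
two-fugacity width-one rate does not exceed the largest root of `s(s−y)(s−z) = yz`, `s = μ²` (conjecturally an equality — the
monotone two-row switch words have exactly this rate; not claimed).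
[cite: BeatonBousquetMelouDeGierDuminilCopinGuttmann2014, §3.2 Proposition 6 (arXiv v5 p. 10: μ_T(y,z)); MadrasSlade1993, §8.2] -/
theorem stripMuY₂_one_sq_poly_le (hy : 0 < y) (hz : 0 < z) (hm : max y z ≤ stripMuY₂ 1 y z ^ 2) :
    stripMuY₂ 1 y z ^ 2 * (stripMuY₂ 1 y z ^ 2 - y) * (stripMuY₂ 1 y z ^ 2 - z) ≤ y * z := by
  set μ := stripMuY₂ 1 y z with hμdef
  have hμ : 0 < μ := stripMuY₂_pos 1 hy hz
  have hyz : 0 < y * z := mul_pos hy hz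
  have hy' : y ≤ μ ^ 2 := (le_max_left _ _).trans hm
  have hz' : z ≤ μ ^ 2 := (le_max_right _ _).trans hm
  by_contra hcon
  rw [not_le] at hcon
  -- strictness: if `μ² = y` or `μ² = z` the product vanishes
  have hsy : y < μ ^ 2 := lt_of_le_of_ne hy' fun h => by rw [← h] at hcon; nlinarith
  have hsz : z < μ ^ 2 := lt_of_le_of_ne hz' fun h => by rw [← h] at hcon; nlinarith
  -- all four strict conditions are open: they hold at some `ρ < μ`
  have hc1 : ContinuousAt (fun ρ : ℝ => ρ ^ 2 * (ρ ^ 2 - y) * (ρ ^ 2 - z) - y * z) μ := by fun_prop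
  have hc2 : ContinuousAt (fun ρ : ℝ => ρ ^ 2 - y) μ := by fun_prop
  have hc3 : ContinuousAt (fun ρ : ℝ => ρ ^ 2 - z) μ := by fun_prop
  have hev : ∀ᶠ ρ in 𝓝 μ, (0 < ρ ^ 2 * (ρ ^ 2 - y) * (ρ ^ 2 - z) - y * z ∧ 0 < ρ ^ 2 - y) ∧ (0 < ρ ^ 2 - z ∧ 0 < ρ) :=
    ((hc1.eventually (lt_mem_nhds (by linarith))).and (hc2.eventually (lt_mem_nhds (by linarith)))).and
      ((hc3.eventually (lt_mem_nhds (by linarith))).and (lt_mem_nhds hμ))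
  obtain ⟨ρ, ⟨⟨h1, h2⟩, h3, hρ0⟩, hρμ⟩ :=
    ((hev.filter_mono nhdsWithin_le_nhds).and (eventually_mem_nhdsWithin (s := Set.Iio μ))).exists
  rw [Set.mem_Iio] at hρμ
  have := stripMuY₂_one_le hy hz hρ0 (by linarith) (by linarith) (by linarith)
  linarith

/-- ★★ **One attractive wall on the one-cell strip: `s(s − y)(s − 1) ≤ y` for `s = μ_1(y,1)² = μ_1(1,y)²`** (`y ≥ 1`; printed
one-variable rate `HexBW.stripMuY₀ 1 y`). [cite: BeatonBousquetMelouDeGierDuminilCopinGuttmann2014, §3.2 Propositions 6–7 (arXiv v5 pp. 10–11)] -/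
theorem stripMuY₀_one_sq_poly_le (hy : 1 ≤ y) :
    stripMuY₀ 1 y ^ 2 * (stripMuY₀ 1 y ^ 2 - y) * (stripMuY₀ 1 y ^ 2 - 1) ≤ y := by
  have hy0 : 0 < y := by linarith
  have hs : y ≤ stripMuY₀ 1 y ^ 2 := by
    have h := pow_le_pow_left₀ (Real.sqrt_nonneg y) (sqrt_le_stripMuY₀ 1 hy) 2
    rwa [Real.sq_sqrt hy0.le] at h
  have h := stripMuY₂_one_sq_poly_le hy0 one_pos (by rw [stripMuY₂_one_right, max_eq_left hy]; exact hs)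
  rw [stripMuY₂_one_right, mul_one] at h
  exact h

/-- ★★ **`μ_1(y,1)² ≤ y + 1/(y − 1)` for every `y > 1`**: the one-wall width-one correction is at most `1/(y−1)` (the lane's lower
bound for it is `3/(10y)`, `HexSAWBrickWallStripFugacityExcursionLower`). [cite: BeatonBousquetMelouDeGierDuminilCopinGuttmann2014, §3.2 Propositions 6–7 (arXiv v5 pp. 10–11)] -/
theorem stripMuY₀_one_sq_le_add_inv (hy : 1 < y) : stripMuY₀ 1 y ^ 2 ≤ y + 1 / (y - 1) := by
  have hy0 : 0 < y := by linarith
  set s := stripMuY₀ 1 y ^ 2 with hs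
  have hsy : y ≤ s := by
    have h := pow_le_pow_left₀ (Real.sqrt_nonneg y) (sqrt_le_stripMuY₀ 1 hy.le) 2
    rwa [Real.sq_sqrt hy0.le] at h
  have h := stripMuY₀_one_sq_poly_le hy.le
  rw [← hs] at h
  -- `s − y ≤ y/(s(s−1)) ≤ y/(y(y−1)) = 1/(y−1)`
  have h1 : 0 < y - 1 := by linarith
  have hss : y * (y - 1) ≤ s * (s - 1) := by nlinarith
  have key : (s - y) * (y * (y - 1)) ≤ y := by nlinarith
  rw [show y + 1 / (y - 1) = y + y / (y * (y - 1)) by field_simp, ← sub_le_iff_le_add', le_div_iff₀ (by positivity)]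
  exact key

/-- ★★ **`μ²(μ² − y)(μ² − z) ≤ yz` for `μ = μ_1(y,z)`, every `y, z ≥ 1`** (then `max(y,z) ≤ μ²` by the zig-zag bound and the
monotonicity / symmetry of Proposition 6). [cite: BeatonBousquetMelouDeGierDuminilCopinGuttmann2014, §3.2 Proposition 6 (arXiv v5 p. 10: μ_T(y,z) non-decreasing in y and z, μ_T(y,z) = μ_T(z,y))] -/
theorem stripMuY₂_one_sq_poly_le_of_one_le (hy : 1 ≤ y) (hz : 1 ≤ z) :
    stripMuY₂ 1 y z ^ 2 * (stripMuY₂ 1 y z ^ 2 - y) * (stripMuY₂ 1 y z ^ 2 - z) ≤ y * z := by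
  have hy0 : 0 < y := by linarith
  have hz0 : 0 < z := by linarith
  -- `y ≤ μ_1(y,1)² ≤ μ_1(y,z)²` and symmetrically in `z`
  have low : ∀ {a b : ℝ}, 1 ≤ a → 1 ≤ b → a ≤ stripMuY₂ 1 a b ^ 2 := by
    intro a b ha hb
    have ha0 : 0 < a := by linarith
    have h1 : Real.sqrt a ≤ stripMuY₂ 1 a b := by
      calc Real.sqrt a ≤ stripMuY₀ 1 a := sqrt_le_stripMuY₀ 1 ha
        _ = stripMuY₂ 1 a 1 := (stripMuY₂_one_right 1 a).symm
        _ ≤ stripMuY₂ 1 a b := stripMuY₂_mono_right 1 ha0 one_pos hb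
    have := pow_le_pow_left₀ (Real.sqrt_nonneg a) h1 2
    rwa [Real.sq_sqrt ha0.le] at this
  have hmy : y ≤ stripMuY₂ 1 y z ^ 2 := low hy hz
  have hmz : z ≤ stripMuY₂ 1 y z ^ 2 := by rw [stripMuY₂_symm]; exact low hz hy
  exact stripMuY₂_one_sq_poly_le hy0 hz0 (max_le hmy hmz)

/-- **The zig-zag bound with a second fugacity: `√y ≤ μ_T(y,z)` for every `T ≥ 1`, `y ≥ 1`, `z > 0`** (the straight walk along
the bottom row never meets a top vertex). [cite: BeatonBousquetMelouDeGierDuminilCopinGuttmann2014, §3.1 Proposition 5 (arXiv v5 p. 9: "zig-zag walks sticking to the surface") and proof of Corollary 8 (p. 12)] -/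
theorem sqrt_le_stripMuY₂_of_one_le {T : ℕ} (hT : 1 ≤ T) (hy : 1 ≤ y) (hz : 0 < z) : Real.sqrt y ≤ stripMuY₂ T y z := by
  have hy0 : 0 < y := one_pos.trans_le hy
  have hK : 1 ≤ yK y * yK z := one_le_mul_of_one_le_of_one_le (one_le_yK y) (one_le_yK z)
  refine le_ciInf fun n => ?_
  have hmem : ((0 : Site 2), Zd.straightWalk 2 (n + 1)) ∈ stripPairs T (n + 1) := by
    have hsw := mem_saws.1 (straightWalk_mem (n + 1))
    exact mem_stripPairs.2 ⟨zero_mem_stripStarts T, hsw.1, fun i hi => by simpa only [zero_add] using hsw.2 i hi,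
      fun m _ => by
        simp only [zero_add, InStrip, Zd.straightWalk, Pi.single_eq_of_ne (one_ne_zero : (1 : Fin 2) ≠ 0)]
        exact ⟨le_rfl, by positivity⟩⟩
  -- the straight walk has no top visits (`T ≥ 1`)
  have htop : topVisits₀ T (0 : Site 2) (Zd.straightWalk 2 (n + 1)) (n + 1) = 0 := by
    unfold topVisits₀
    refine Finset.sum_eq_zero fun m _ => ?_
    rw [if_neg]
    rintro ⟨h, -⟩
    simp only [zero_add, Zd.straightWalk, Pi.single_eq_of_ne (one_ne_zero : (1 : Fin 2) ≠ 0)] at h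
    have : (1 : ℤ) ≤ (T : ℤ) := by exact_mod_cast hT
    omega
  have hZ : y ^ ((n + 2) / 2) ≤ yK y * yK z * stripZ₂ T (n + 1) y z := by
    have h1 : y ^ ((n + 2) / 2) ≤ y ^ bottomVisits₀ (0 : Site 2) (Zd.straightWalk 2 (n + 1)) (n + 1) *
        z ^ topVisits₀ T (0 : Site 2) (Zd.straightWalk 2 (n + 1)) (n + 1) := by
      rw [htop, pow_zero, mul_one]
      exact pow_le_pow_right₀ hy (div_two_le_bottomVisits₀_straightWalk (n + 1))
    calc y ^ ((n + 2) / 2) ≤ stripZ₂ T (n + 1) y z := h1.trans (Finset.single_le_sum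
          (f := fun p : Site 2 × (ℕ → Site 2) => y ^ bottomVisits₀ p.1 p.2 (n + 1) * z ^ topVisits₀ T p.1 p.2 (n + 1))
          (fun p _ => mul_nonneg (pow_nonneg hy0.le _) (pow_nonneg hz.le _)) hmem)
      _ ≤ yK y * yK z * stripZ₂ T (n + 1) y z := le_mul_of_one_le_left (stripZ₂_pos T _ hy0 hz).le hK
  have hreal : y ^ (((n : ℝ) + 1) / 2) ≤ y ^ ((n + 2) / 2) := by
    rw [← Real.rpow_natCast y ((n + 2) / 2)]
    refine Real.rpow_le_rpow_of_exponent_le hy ?_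
    have : (n + 1 : ℕ) ≤ 2 * ((n + 2) / 2) := by omega
    have h' : ((n : ℝ) + 1) ≤ 2 * (((n + 2) / 2 : ℕ) : ℝ) := by exact_mod_cast this
    linarith
  have hpos : (0 : ℝ) < (n : ℝ) + 1 := by positivity
  calc Real.sqrt y = (y ^ (((n : ℝ) + 1) / 2)) ^ (1 / ((n : ℝ) + 1)) := by
        rw [← Real.rpow_mul hy0.le, Real.sqrt_eq_rpow]
        congr 1; field_simp
    _ ≤ (y ^ ((n + 2) / 2)) ^ (1 / ((n : ℝ) + 1)) :=
        Real.rpow_le_rpow (Real.rpow_nonneg hy0.le _) hreal (by positivity)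
    _ ≤ (yK y * yK z * stripZ₂ T (n + 1) y z) ^ (1 / ((n : ℝ) + 1)) :=
        Real.rpow_le_rpow (pow_nonneg hy0.le _) hZ (by positivity)

/-- ★★ **`μ²(μ² − y)(μ² − z) ≤ yz` for `μ = μ_1(y,z)`, every `y ≥ 1` and EVERY `z > 0`** — one attractive wall, the other wall
arbitrary (attractive, neutral or repulsive): `max(y,z) ≤ μ²` by the zig-zag bound on each wall and symmetry.
[cite: BeatonBousquetMelouDeGierDuminilCopinGuttmann2014, §3.2 Proposition 6 (arXiv v5 p. 10: μ_T(y,z) = μ_T(z,y))] -/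
theorem stripMuY₂_one_sq_poly_le_of_one_le_left (hy : 1 ≤ y) (hz : 0 < z) :
    stripMuY₂ 1 y z ^ 2 * (stripMuY₂ 1 y z ^ 2 - y) * (stripMuY₂ 1 y z ^ 2 - z) ≤ y * z := by
  have hy0 : 0 < y := by linarith
  have sq : ∀ {a b : ℝ}, 1 ≤ a → 0 < b → a ≤ stripMuY₂ 1 a b ^ 2 := by
    intro a b ha hb
    have h := pow_le_pow_left₀ (Real.sqrt_nonneg a) (sqrt_le_stripMuY₂_of_one_le le_rfl ha hb) 2
    rwa [Real.sq_sqrt (by linarith)] at h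
  have hmy : y ≤ stripMuY₂ 1 y z ^ 2 := sq hy hz
  have hmz : z ≤ stripMuY₂ 1 y z ^ 2 := by
    rcases le_or_gt z y with h | h
    · exact h.trans hmy
    · rw [stripMuY₂_symm]; exact sq (by linarith) hy0
  exact stripMuY₂_one_sq_poly_le hy0 hz (max_le hmy hmz)

end Literature.Probability.RandomPlanarGeometry.SAW.HexBW
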